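import Literature.MathematicalPhysics.KineticTheory.DiPernaLionsLimitEntropyAssembly
import Literature.MathematicalPhysics.KineticTheory.VelocityAveragingProofs
import HarnessLib

/-!
# Discharged fact (B3): the entropy inequality of the DiPerna–Lions weak limit

Topic: MathematicalPhysics / KineticTheory. The named fact (B3)
`Literature.MathematicalPhysics.KineticTheory.diPernaLions_limit_entropyInequality` of
`DiPernaLionsLimit` (DiPerna–Lions 1991; Lions 1993 Thm III.4 with (E) p. 54;
Cercignani–Illner–Pulvirenti 1994 §5.3 Step 14, last display p. 160) was proved in
`DiPernaLionsLimitEntropyAssembly` granted the velocity-averaging lemma CIP 5.3.9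
(`diPernaLions_limit_entropyInequality_of_velocityAveraging`); that lemma is now proved
(`velocityAverage_relativelyCompact_L1_holds`, `VelocityAveragingProofs`), so (B3) is discharged
here: `diPernaLions_limit_entropyInequality_holds`. Everything in this file is proved.

## References

* R. J. DiPerna, P.-L. Lions, *Global solutions of Boltzmann's equation and the entropy
  inequality*, Arch. Rational Mech. Anal. 114 (1991) 47–55.
* P.-L. Lions, *Global solutions of kinetic models and related problems*, in: Nonequilibrium
  Problems in Many-Particle Systems, LNM 1551 (1993), Thm III.4 (p. 57) and (E) (p. 54).
* C. Cercignani, R. Illner, M. Pulvirenti, *The Mathematical Theory of Dilute Gases*, Springer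
  (1994), §5.3 Lemma 5.3.9 (p. 154) and Step 14 (p. 160).
-/

namespace Literature.MathematicalPhysics.KineticTheory

universe u

/-- **(B3) discharged** (DiPerna–Lions 1991; Lions 1993 Thm III.4 (E); CIP 1994 §5.3 Step 14,
last display p. 160): in the setting of `diPernaLions_extraction`, every weak limit `f` satisfies
the entropy inequality `H(f(t)) + ∫₀ᵗ∫ e(f) dx ds ≤ H(f₀)`. Proof:
`diPernaLions_limit_entropyInequality_of_velocityAveraging` (lower semicontinuity of entropy and
dissipation along the approximating sequence, through the weak limits of the normalised tensor
products) applied to the proved velocity-averaging lemma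
`velocityAverage_relativelyCompact_L1_holds` (CIP Lemma 5.3.9). [cite: CIPDiluteGases1994, §5.3 Step 14 (p. 160)]
[cite: Lions1993Kinetic, Thm III.4 (p. 57) and (E) (p. 54)] -/
theorem diPernaLions_limit_entropyInequality_holds : diPernaLions_limit_entropyInequality.{u} :=
  diPernaLions_limit_entropyInequality_of_velocityAveraging velocityAverage_relativelyCompact_L1_holds

end Literature.MathematicalPhysics.KineticTheory
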